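import Summits.MatrixMultiplication.MatrixMultiplication.Theses.EisensteinValCertificates
import Summits.MatrixMultiplication.MatrixMultiplication.Theses.FourierTwoFamiliesModP
import Literature.Computability.AlgebraicComplexity.SimultaneousDoubleProduct
import Summits.MatrixMultiplication.MatrixMultiplication.Theorems.EisensteinValCertificatesHomocyclicSTPPDesignsOfClusteredTwoFamilies
import Summits.MatrixMultiplication.MatrixMultiplication.Theorems.EisensteinValCertificatesHomocyclicSTPPDesignsStubLeafPacking
import Summits.MatrixMultiplication.MatrixMultiplication.Theorems.EisensteinValCertificatesHomocyclicSTPPDesignsStubLeafVersusPowerGain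

/-!
# The clustered leaf between the items of two routes (line `registered`, clustered-charts reshape:
# kill-side assembly and the sandwich)

Crux `EisensteinValCertificates.HomocyclicSTPPDesigns` (stmt-MatrixMultiplication-10647) = X′ is closed
modulo ONE open existence statement, the CLUSTERED TWO-FAMILIES LEAF (registered stub
`stub_clusteredTwoFamilies`; reduction `homocyclicSTPPDesigns_of_clusteredTwoFamilies`, landed in
`…OfClusteredTwoFamilies.lean`):

  for every `ε > 0` a prime `p`, an SDPP family `(A_t,B_t)_{t<n}` in `ℤ/p` (tree `IsSDPP`) with
  `|A_t| = a`, `|B_t| = b`, `ab ≥ 2`, a class map `cls : Fin n → Fin m` with pairwise DISJOINT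
  cross-class difference sets and classes of size `≥ d`, and MERIT `m · d^{2/3} · (ab)^{(2+ε)/3} > p`.

This file assembles the kill-side calibration stubs of lead c3's wave 2 (`stub_leafPacking` p155654,
`stub_leafVersusPowerGain` p155804; the swap symmetry `stub_leafSwap`, p155479, is re-proved here
privately as `sandwich_swap` to keep this file's import closure small) into

* `not_clusteredTwoFamilies_of_primeCyclicPowerGain` — **`PrimeCyclicPowerGain ⟹ ¬ leaf`**: the kill
  crux of route FourierTwoFamiliesModP (stmt-MatrixMultiplication-14309: a fixed power saving
  `n · s^{1+c} ≤ p` for BALANCED SDPP configurations `|A_i| = |B_i| = s ≥ s₀` in every `ℤ/p`) refutes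
  every clustered generalisation of CKSU Conj. 4.7 at primes.  The balancing subtlety (14309 speaks of
  balanced configurations only) is paid by the packing of leaf witnesses: merit forces
  `p³ < m n² (ab)^{2+ε}`, the refined packings `(n−1)a + m·ab ≤ p`, `(n−1)b + m·ab ≤ p` force
  `(ab)^ε > 27/16`, and `n ≤ p/b` forces `b^{1−ε} < a^{1+ε}` — so `a` and `b` are polynomially
  comparable, `a ≥ s₀` for small `ε`, and shrinking the `B_i` to size `a` keeps enough merit to
  contradict `n a^{1+c} ≤ p`;

and records the resulting SANDWICH of the leaf between EXISTING items (`clusteredTwoFamilies_sandwich`):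

  `PrimeTwoFamilies` (stmt-14308) ⟹ leaf ⟹ `HomocyclicSTPPDesigns` (stmt-10647) [⟹ CThesis ⟹ ω = 2],
  `PrimeCyclicPowerGain` (stmt-14309) ⟹ ¬ leaf,   `NoHomocyclicSTPP` (stmt-7787) ⟹ ¬ leaf.

So the leaf is a positive existence statement strictly between the deciding items of the two routes
that want this crux neighbourhood: weaker than CKSU Conj. 4.7 at primes, refuted by either kill ladder.
Nothing here is cited as a published fact; sources for the notions: Cohn–Kleinberg–Szegedy–Umans 2005
(FOCS; arXiv:math/0511460) §4 Def. 4.1 / Conj. 4.7, §6 Thm. 37; Pratt 2024 (ITCS) §4.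
-/

set_option linter.dupNamespace false
-- (single-conjunct summit: the namespace repeats `MatrixMultiplication`)

namespace Summit.MatrixMultiplication.MatrixMultiplication.Theorems.HomocyclicSTPPDesigns.ClusteredCharts

open Summit.MatrixMultiplication.MatrixMultiplication.Theses.EisensteinValCertificates
open Summit.MatrixMultiplication.MatrixMultiplication.Theses.FourierTwoFamiliesModP (PrimeTwoFamilies
  PrimeCyclicPowerGain)
open Literature.Computability.AlgebraicComplexity Finset
open scoped BigOperators Pointwise

/-- Swapping the two families of an SDPP family preserves the SDPP: clause (W) is symmetric by
commutativity of addition, and clause (X) for `(B, A)` at `(i, j, k)` is clause (X) for `(A, B)` at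
`(k, j, i)` applied to the negated relation (same proof as the landed `stub_leafSwap`, p155479). -/
private theorem sandwich_swap_isSDPP {H : Type*} [AddCommGroup H] {n : ℕ} {A B : Fin n → Finset H}
    (hS : IsSDPP A B) : IsSDPP B A := by
  refine ⟨fun i b hb b' hb' a ha a' ha' h0 => ?_, fun i j k b hb b' hb' a ha a' ha' h0 => ?_⟩
  · rw [add_comm] at h0
    obtain ⟨h1, h2⟩ := hS.dpp i ha ha' hb hb' h0
    exact ⟨h2, h1⟩
  · have h0' : (a' - a) + (b' - b) = 0 := by
      rw [← neg_eq_zero, ← h0]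
      abel
    exact (hS.simultaneous ha' ha hb' hb h0').symm

/-- Disjointness of difference sets survives swapping the arguments of both differences
(`t - s = -(s - t)`, membership-wise). -/
private theorem sandwich_swap_disjoint {H : Type*} [AddCommGroup H] [DecidableEq H]
    {s t s' t' : Finset H} (h : Disjoint (s - t) (s' - t')) : Disjoint (t - s) (t' - s') := by
  rw [Finset.disjoint_left] at h ⊢
  intro x hx hx'
  rw [Finset.mem_sub] at hx hx'
  obtain ⟨b, hb, a, ha, rfl⟩ := hx
  obtain ⟨b', hb', a', ha', he⟩ := hx'
  refine h (Finset.sub_mem_sub ha hb) ?_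
  have he' : a - b = a' - b' := by
    rw [← neg_sub b a, ← he, neg_sub]
  rw [he']
  exact Finset.sub_mem_sub ha' hb'

/-- The swap statement consumed by `stub_leafVersusPowerGain` (= the landed `stub_leafSwap`,
re-proved from the two private lemmas above). -/
private theorem sandwich_swap :
    ∀ (p n m : ℕ) (A B : Fin n → Finset (ZMod p)) (cls : Fin n → Fin m),
      IsSDPP A B → (∀ i j, cls i ≠ cls j → Disjoint (A i - B i) (A j - B j)) →
      IsSDPP B A ∧ (∀ i j, cls i ≠ cls j → Disjoint (B i - A i) (B j - A j)) := by
  intro p n m A B cls hS hD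
  exact ⟨sandwich_swap_isSDPP hS, fun i j hij => sandwich_swap_disjoint (hD i j hij)⟩

/-- **`PrimeCyclicPowerGain ⟹ ¬ (clustered two-families leaf)`** (registered stub
`not_clusteredTwoFamilies_of_primeCyclicPowerGain`; kill side of line `registered`): a fixed power
saving for balanced SDPP configurations in prime cyclic groups (route FourierTwoFamiliesModP, item
stmt-MatrixMultiplication-14309) excludes clustered SDPP families with merit for every `ε`.  Assembled
from the landed stubs `stub_leafVersusPowerGain` (the argument) and `stub_leafPacking` (the six packing
inequalities), with the `A ↔ B` symmetry (`sandwich_swap`, = the landed `stub_leafSwap`) for WLOG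
`a ≤ b`. -/
theorem not_clusteredTwoFamilies_of_primeCyclicPowerGain :
    PrimeCyclicPowerGain →
    ¬ ∀ ε : ℝ, 0 < ε → ∃ p : ℕ, p.Prime ∧ ∃ (n m a b d : ℕ) (A B : Fin n → Finset (ZMod p))
      (cls : Fin n → Fin m), IsSDPP A B ∧ 2 ≤ a * b ∧ (∀ i, (A i).card = a ∧ (B i).card = b) ∧
      (∀ i j, cls i ≠ cls j → Disjoint (A i - B i) (A j - B j)) ∧
      (∀ c : Fin m, d ≤ (Finset.univ.filter fun i => cls i = c).card) ∧
      (p : ℝ) < (m : ℝ) * (d : ℝ) ^ ((2 : ℝ) / 3) * ((a * b : ℕ) : ℝ) ^ ((2 + ε) / 3) :=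
  stub_leafVersusPowerGain stub_leafPacking sandwich_swap

/-- **The sandwich of the clustered leaf between existing items** (bookkeeping, all four arrows are
landed theorems): `PrimeTwoFamilies ⟹ leaf` (`stub_clusteredOfPrimeTwoFamilies`, p154020),
`leaf ⟹ HomocyclicSTPPDesigns` (`homocyclicSTPPDesigns_of_clusteredTwoFamilies`, p155276),
`PrimeCyclicPowerGain ⟹ ¬ leaf` (`not_clusteredTwoFamilies_of_primeCyclicPowerGain`),
`NoHomocyclicSTPP ⟹ ¬ leaf` (`not_clusteredTwoFamilies_of_noHomocyclicSTPP`, p155276). -/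
theorem clusteredTwoFamilies_sandwich :
    let Leaf : Prop := ∀ ε : ℝ, 0 < ε → ∃ p : ℕ, p.Prime ∧ ∃ (n m a b d : ℕ)
      (A B : Fin n → Finset (ZMod p)) (cls : Fin n → Fin m), IsSDPP A B ∧ 2 ≤ a * b ∧
      (∀ i, (A i).card = a ∧ (B i).card = b) ∧
      (∀ i j, cls i ≠ cls j → Disjoint (A i - B i) (A j - B j)) ∧
      (∀ c : Fin m, d ≤ (Finset.univ.filter fun i => cls i = c).card) ∧
      (p : ℝ) < (m : ℝ) * (d : ℝ) ^ ((2 : ℝ) / 3) * ((a * b : ℕ) : ℝ) ^ ((2 + ε) / 3)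
    (PrimeTwoFamilies → Leaf) ∧ (Leaf → HomocyclicSTPPDesigns) ∧
      (PrimeCyclicPowerGain → ¬ Leaf) ∧ (NoHomocyclicSTPP → ¬ Leaf) :=
  ⟨stub_clusteredOfPrimeTwoFamilies, homocyclicSTPPDesigns_of_clusteredTwoFamilies,
    not_clusteredTwoFamilies_of_primeCyclicPowerGain, not_clusteredTwoFamilies_of_noHomocyclicSTPP⟩

end Summit.MatrixMultiplication.MatrixMultiplication.Theorems.HomocyclicSTPPDesigns.ClusteredCharts
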